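import Literature.Geometry.Symplectic.GromovR4StdModel
import Literature.Geometry.Manifold.VectorSpaceGlobalFlow
import Literature.Geometry.Manifold.InjOnLocalDiffeomorphInverse

/-!
# The Liouville field of the jacket form is smooth and has a global cut-off flow

Helper file of stub `stub_liouvilleCollar` (line `kaehler-jacket`, crux stmt-SmoothPoincare4-7823;
Geiges 2008, Lemma/Definition 1.4.5 and Lemma 5.2.4).  In the chart of the inner sphere the jacket
is an immersion `F` of a shell `W = {|‖y − c‖ − μ| < δ}` of `ℝ⁴` into `(ℝ⁴, ω₀)`, `a` is a smooth
`1`-form on `W`, and `Z` is the `ω_F`-dual field of `a`: `ω₀(DF_y Z_y, DF_y w) = a_y(w)`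
(`ω_F = F^*ω₀` is non-degenerate, `DF_y` being invertible).  We prove (`helper_kjLiouvilleFlow`):

* `Z` is smooth on `W`: `Z_y = B_y⁻¹ a_y` for the smooth family of invertible operators
  `B_y v = ω₀(DF_y v, DF_y ·)` (`ContinuousLinearMap.inverse` is smooth at invertible operators);
* multiplied by a bump function of `‖y − c‖²` it becomes a smooth compactly supported field `V`
  on `ℝ⁴`, equal to `Z` on a thinner shell, which therefore has a smooth global flow
  `θ : ℝ × ℝ⁴ → ℝ⁴` (`Literature.Geometry.Manifold.exists_contDiff_globalFlow`, Lee 2013,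
  Thm. 9.16).

## References

* H. Geiges, *An Introduction to Contact Topology*, CUP 2008, Lemma/Definition 1.4.5,
  Lemma 5.2.4. [Geiges2008]
* J. M. Lee, *Introduction to Smooth Manifolds*, 2nd ed. (2013), Thm. 9.16. [LeeSmoothManifolds2013]
-/

noncomputable section

set_option linter.dupNamespace false

open scoped Manifold ContDiff Topology
open Set Function Metric
open Literature.Geometry.Symplectic (stdSymplecticForm stdSymplecticBilin stdSymplecticBilin_apply
  stdSymplecticForm_self stdSymplecticForm_rot_eq_norm_sq)

namespace Summit.SmoothPoincare4.SmoothPoincare4.Theorems.Target.KaehlerJacket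

/-- Model space `ℝ⁴ = ℂ²`. -/
local notation "E4" => EuclideanSpace ℝ (Fin 4)

/-! ### The pulled-back symplectic pairing `B_L v = ω₀(L v, L ·)` -/

/-- `B_L v w = ω₀(L v, L w)`. [folklore] -/
theorem symplecticPairing_apply (L : E4 →L[ℝ] E4) (v w : E4) :
    ((ContinuousLinearMap.compL ℝ E4 E4 ℝ).flip L).comp (stdSymplecticBilin.comp L) v w =
      stdSymplecticForm (L v) (L w) := by
  simp only [ContinuousLinearMap.flip_apply, ContinuousLinearMap.coe_comp, Function.comp_apply,
    ContinuousLinearMap.compL_apply, stdSymplecticBilin_apply]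

/-- `L ↦ B_L` is smooth (a polynomial map in `L`). [folklore] -/
theorem contDiff_symplecticPairing :
    ContDiff ℝ ∞ fun L : E4 →L[ℝ] E4 =>
      ((ContinuousLinearMap.compL ℝ E4 E4 ℝ).flip L).comp (stdSymplecticBilin.comp L) := by
  have h1 : ContDiff ℝ ∞ fun L : E4 →L[ℝ] E4 => stdSymplecticBilin.comp L :=
    contDiff_const.clm_comp contDiff_id
  exact ((ContinuousLinearMap.compL ℝ E4 E4 ℝ).flip.contDiff).clm_comp h1

/-- `dim (ℝ⁴ →L ℝ) = dim ℝ⁴`. [folklore] -/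
theorem finrank_dual_E4 : Module.finrank ℝ E4 = Module.finrank ℝ (E4 →L[ℝ] ℝ) := by
  rw [← (LinearMap.toContinuousLinearMap : (E4 →ₗ[ℝ] ℝ) ≃ₗ[ℝ] E4 →L[ℝ] ℝ).finrank_eq]
  exact (Subspace.dual_finrank_eq).symm

/-- **`ω_F` is non-degenerate**: for invertible (injective) `L`, `B_L` is bijective.
[cite: Geiges2008, Lemma/Definition 1.4.5] -/
theorem bijective_symplecticPairing {L : E4 →L[ℝ] E4} (hL : Injective L) :
    Bijective
      (((ContinuousLinearMap.compL ℝ E4 E4 ℝ).flip L).comp (stdSymplecticBilin.comp L)) := by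
  set B := ((ContinuousLinearMap.compL ℝ E4 E4 ℝ).flip L).comp (stdSymplecticBilin.comp L) with hB
  have hsurjL : Surjective L :=
    (LinearMap.injective_iff_surjective (f := (L : E4 →ₗ[ℝ] E4))).1 hL
  have hinj : Injective B := by
    rw [injective_iff_map_eq_zero]
    intro v hv
    have hall : ∀ w' : E4, stdSymplecticForm (L v) w' = 0 := by
      intro w'
      obtain ⟨w, rfl⟩ := hsurjL w'
      have := congrArg (fun φ : E4 →L[ℝ] ℝ => φ w) hv
      simpa only [hB, symplecticPairing_apply, zero_apply] using this
    have hLv : L v = 0 := by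
      have h := hall (WithLp.toLp 2 ![-(L v) 1, (L v) 0, -(L v) 3, (L v) 2])
      rw [stdSymplecticForm_rot_eq_norm_sq] at h
      exact norm_eq_zero.1 (pow_eq_zero_iff two_ne_zero |>.1 h)
    exact (injective_iff_map_eq_zero L).1 hL v hLv
  exact ⟨hinj, (LinearMap.injective_iff_surjective_of_finrank_eq_finrank finrank_dual_E4
    (f := (B : E4 →ₗ[ℝ] (E4 →L[ℝ] ℝ)))).1 hinj⟩

/-! ### Smoothness of the Liouville field -/

section Field

variable {c : E4} {μ δ : ℝ} {F : E4 → E4} {a : E4 → E4 →L[ℝ] ℝ} {Z : E4 → E4}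

/-- **The Liouville field is smooth.**  On the shell where `F` is a smooth immersion and `a` is
smooth, the `ω_F`-dual field `Z` of `a` agrees with the smooth field
`y ↦ B_{DF_y}⁻¹ a_y`. [cite: Geiges2008, Lemma/Definition 1.4.5] -/
theorem liouvilleField_contDiffAt
    (hF : ∀ y : E4, |‖y - c‖ - μ| < δ →
      ContDiffAt ℝ ∞ F y ∧ Injective (fderiv ℝ F y) ∧ ContDiffAt ℝ ∞ a y)
    (hdual : ∀ y : E4, |‖y - c‖ - μ| < δ → ∀ w : E4,
      stdSymplecticForm (fderiv ℝ F y (Z y)) (fderiv ℝ F y w) = a y w)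
    {y : E4} (hy : |‖y - c‖ - μ| < δ) :
    ContDiffAt ℝ ∞ (fun y => ContinuousLinearMap.inverse
      (((ContinuousLinearMap.compL ℝ E4 E4 ℝ).flip (fderiv ℝ F y)).comp
        (stdSymplecticBilin.comp (fderiv ℝ F y))) (a y)) y ∧
    ContinuousLinearMap.inverse
      (((ContinuousLinearMap.compL ℝ E4 E4 ℝ).flip (fderiv ℝ F y)).comp
        (stdSymplecticBilin.comp (fderiv ℝ F y))) (a y) = Z y := by
  obtain ⟨hFy, hinj, hay⟩ := hF y hy
  set B : E4 → E4 →L[ℝ] E4 →L[ℝ] ℝ := fun y =>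
    ((ContinuousLinearMap.compL ℝ E4 E4 ℝ).flip (fderiv ℝ F y)).comp
      (stdSymplecticBilin.comp (fderiv ℝ F y)) with hB_def
  have hbij := bijective_symplecticPairing hinj
  set e := Literature.Geometry.Manifold.continuousLinearEquivOfBijective _ hbij with he_def
  have he : (e : E4 →L[ℝ] E4 →L[ℝ] ℝ) = B y :=
    Literature.Geometry.Manifold.coe_continuousLinearEquivOfBijective _ hbij
  have hBs : ContDiffAt ℝ ∞ B y :=
    contDiff_symplecticPairing.contDiffAt.comp y (hFy.fderiv_right (m := ∞) (by simp))
  have hinv : ContDiffAt ℝ ∞ (fun y => ContinuousLinearMap.inverse (B y)) y := by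
    have h := contDiffAt_map_inverse (n := ∞) e
    rw [he] at h
    exact h.comp y hBs
  refine ⟨hinv.clm_apply hay, ?_⟩
  show ContinuousLinearMap.inverse (B y) (a y) = Z y
  have hBZ : B y (Z y) = a y := by
    ext w
    rw [hB_def, symplecticPairing_apply, hdual y hy w]
  rw [← he, ContinuousLinearMap.inverse_equiv, ← hBZ, ← he]
  exact e.symm_apply_apply (Z y)

end Field

/-! ### Shell arithmetic -/

/-- On the thin shell `|‖y − c‖ − μ| < δ/16` (`δ ≤ μ`): `|‖y − c‖² − μ²| ≤ μδ/4`. [folklore] -/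
theorem abs_sq_sub_sq_le_of_thin {c y : E4} {μ δ : ℝ} (hμ : 0 < μ) (hδ : 0 < δ) (hδμ : δ ≤ μ)
    (hy : |‖y - c‖ - μ| < δ / 16) : |‖y - c‖ ^ 2 - μ ^ 2| ≤ μ * δ / 4 := by
  have h1 := abs_lt.1 hy
  have hfac : ‖y - c‖ ^ 2 - μ ^ 2 = (‖y - c‖ - μ) * (‖y - c‖ + μ) := by ring
  rw [hfac, abs_mul]
  have hsum : |‖y - c‖ + μ| ≤ 2 * μ + μ / 16 := by
    rw [abs_le]; constructor <;> nlinarith [norm_nonneg (y - c)]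
  calc |‖y - c‖ - μ| * |‖y - c‖ + μ| ≤ (δ / 16) * (2 * μ + μ / 16) :=
        mul_le_mul hy.le hsum (abs_nonneg _) (by positivity)
    _ ≤ μ * δ / 4 := by nlinarith

/-- Off the shell `|‖y − c‖ − μ| < δ`: `μδ/2 < |‖y − c‖² − μ²|`. [folklore] -/
theorem lt_abs_sq_sub_sq_of_not_shell {c y : E4} {μ δ : ℝ} (hμ : 0 < μ) (hδ : 0 < δ)
    (hy : ¬ |‖y - c‖ - μ| < δ) : μ * δ / 2 < |‖y - c‖ ^ 2 - μ ^ 2| := by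
  have hfac : ‖y - c‖ ^ 2 - μ ^ 2 = (‖y - c‖ - μ) * (‖y - c‖ + μ) := by ring
  rw [hfac, abs_mul, abs_of_nonneg (by positivity : 0 ≤ ‖y - c‖ + μ)]
  have h1 : δ ≤ |‖y - c‖ - μ| := le_of_not_gt hy
  have h2 : μ ≤ ‖y - c‖ + μ := by linarith [norm_nonneg (y - c)]
  calc μ * δ / 2 < δ * μ := by nlinarith
    _ ≤ |‖y - c‖ - μ| * (‖y - c‖ + μ) := mul_le_mul h1 h2 hμ.le (abs_nonneg _)

/-! ### The cut-off field and its flow -/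

/-- **The Liouville field: smoothness, cut-off, global flow** (`helper_kjLiouvilleFlow`).  On a
shell `W = {|‖y − c‖ − μ| < δ}` (`0 < δ ≤ μ`) let `F` be a smooth immersion into `ℝ⁴`, `a` a smooth
`1`-form and `Z` the `ω_F`-dual field of `a` (`ω₀(DF Z, DF w) = a(w)`).  Then there are a smooth
vector field `V` on `ℝ⁴`, a smooth map `θ : ℝ × ℝ⁴ → ℝ⁴` and `0 < δ' ≤ δ` such that
`θ(0, x) = x`, `∂ₜθ(t, x) = V(θ(t, x))`, and `V = Z` on the shell `{|‖y − c‖ − μ| < δ'}` (Geiges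
2008, Lemma/Definition 1.4.5: the Liouville field; Lee 2013, Thm. 9.16: compactly supported fields
are complete). [cite: Geiges2008, Lemma/Definition 1.4.5] -/
theorem helper_kjLiouvilleFlow :
    ∀ (c : E4) (μ δ : ℝ) (F : E4 → E4) (a : E4 → E4 →L[ℝ] ℝ) (Z : E4 → E4),
      0 < μ → 0 < δ → δ ≤ μ →
      (∀ y : E4, |‖y - c‖ - μ| < δ →
        ContDiffAt ℝ ∞ F y ∧ Injective (fderiv ℝ F y) ∧ ContDiffAt ℝ ∞ a y) →
      (∀ y : E4, |‖y - c‖ - μ| < δ → ∀ w : E4,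
        stdSymplecticForm (fderiv ℝ F y (Z y)) (fderiv ℝ F y w) = a y w) →
      ∃ (V : E4 → E4) (θ : ℝ × E4 → E4) (δ' : ℝ), 0 < δ' ∧ δ' ≤ δ ∧
        ContDiff ℝ ∞ V ∧ ContDiff ℝ ∞ θ ∧ (∀ x, θ (0, x) = x) ∧
        (∀ x t, HasDerivAt (fun t => θ (t, x)) (V (θ (t, x))) t) ∧
        (∀ y : E4, |‖y - c‖ - μ| < δ' → V y = Z y) := by
  intro c μ δ F a Z hμ hδ hδμ hF hdual
  -- the smooth model of `Z`
  set Zs : E4 → E4 := fun y => ContinuousLinearMap.inverse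
    (((ContinuousLinearMap.compL ℝ E4 E4 ℝ).flip (fderiv ℝ F y)).comp
      (stdSymplecticBilin.comp (fderiv ℝ F y))) (a y) with hZs_def
  have hZs : ∀ y : E4, |‖y - c‖ - μ| < δ → ContDiffAt ℝ ∞ Zs y ∧ Zs y = Z y :=
    fun y hy => liouvilleField_contDiffAt hF hdual hy
  -- the bump in `‖y − c‖²`
  let b : ContDiffBump (μ ^ 2 : ℝ) := ⟨μ * δ / 4, μ * δ / 2, by positivity, by nlinarith⟩
  set χ : E4 → ℝ := fun y => b (‖y - c‖ ^ 2) with hχ_def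
  have hχs : ContDiff ℝ ∞ χ := b.contDiff.comp ((contDiff_id.sub contDiff_const).norm_sq ℝ)
  have hχ1 : ∀ y : E4, |‖y - c‖ - μ| < δ / 16 → χ y = 1 := by
    intro y hy
    apply b.one_of_mem_closedBall
    rw [mem_closedBall, Real.dist_eq]
    exact abs_sq_sub_sq_le_of_thin hμ hδ hδμ hy
  have hχ0 : ∀ y : E4, μ * δ / 2 < |‖y - c‖ ^ 2 - μ ^ 2| → χ y = 0 := by
    intro y hy
    apply b.zero_of_le_dist
    rw [Real.dist_eq]
    exact hy.le
  -- the cut-off field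
  set V : E4 → E4 := fun y => χ y • Zs y with hV_def
  have hVs : ContDiff ℝ ∞ V := by
    rw [contDiff_iff_contDiffAt]
    intro y
    by_cases hy : |‖y - c‖ - μ| < δ
    · exact hχs.contDiffAt.smul (hZs y hy).1
    · -- `V = 0` near `y`
      have hN : IsOpen {y' : E4 | μ * δ / 2 < |‖y' - c‖ ^ 2 - μ ^ 2|} :=
        isOpen_lt continuous_const ((continuous_id.sub continuous_const).norm.pow 2
          |>.sub continuous_const).abs
      have hev : V =ᶠ[𝓝 y] fun _ => 0 := by
        filter_upwards [hN.mem_nhds (lt_abs_sq_sub_sq_of_not_shell hμ hδ hy)] with y' hy'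
        show χ y' • Zs y' = 0
        rw [hχ0 y' hy', zero_smul]
      exact (contDiffAt_const (c := (0 : E4))).congr_of_eventuallyEq hev
  have hVK : ∀ y, y ∉ closedBall c (μ + δ) → V y = 0 := by
    intro y hy
    rw [mem_closedBall, dist_eq_norm, not_le] at hy
    have hns : ¬ |‖y - c‖ - μ| < δ := by
      rw [abs_lt, not_and_or]
      exact Or.inr (by linarith)
    show χ y • Zs y = 0
    rw [hχ0 y (lt_abs_sq_sub_sq_of_not_shell hμ hδ hns), zero_smul]
  obtain ⟨θ, hθ, hθ0, -, hflow, -⟩ :=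
    Literature.Geometry.Manifold.exists_contDiff_globalFlow hVs (isCompact_closedBall c (μ + δ)) hVK
  refine ⟨V, θ, δ / 16, by positivity, by linarith, hVs, hθ, hθ0, hflow, fun y hy => ?_⟩
  show χ y • Zs y = Z y
  rw [hχ1 y hy, one_smul, (hZs y (by have := abs_lt.1 hy; rw [abs_lt]; constructor <;> linarith)).2]

end Summit.SmoothPoincare4.SmoothPoincare4.Theorems.Target.KaehlerJacket

end
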